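import Summits.QuantumFields.BalabanUV.Beta.GAN24.ContactRefinePWeights

/-!
# `BalabanUV.Beta.GAN24.CombContactRefinePWeights` — binder row G-an2-4 ∕ (CONV-C), TRANSFER-III, the (III′) S-slot (b), the Wilson contact RATE END `hCTd′`, step CT-4c-P AT THE COMB CHART:
# **THE OWNER's PAIRING WEIGHTS FOR «GEOMETRIC + TWO FINEST SPIKES» LETTERS** — the rows MY (III′) differenced staircase `ΔG′` produces (`CombContactGaugeStaircaseCauchyHolds`:
# `aΔ′ s = α₀·[s = 0] + α₁·[s = 1] + θ^k·α·Lc^s` — the (E) spike at scale `0` AND the face spike at scale `1`): road-P2 g34's `ContactRefinePWeights` (one spike) plus the SCALE-`1`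
# spike ROW `((K:ℝ)+1)·2e^{5κ₀}(Φ₀ + τ)α₁β` and COLUMN `2e^{5κ₀}αβ₁(((K:ℝ)+1)τ + 2Φ₀Lc^K)` — the same `(k+2)·N′⁻¹`-type log as the scale-`0` spike.

NOT IN PRINT; OUR BOOKKEEPING (leaf prover `b2b-balaban-gan24-formalise-leaf-01`, gen 89; pure real algebra over road-P2's `sum_weights_mono ∕ sum_weights_add_left ∕ _right ∕
sum_weights_spike_left_le ∕ _right_le` and the OWNER gan24-p1 g18's `StaircasePairing.sum_weights_le_of_geometric ∕ sum_pow_le` BY NAME; 0 `def`, 0 cited facts, 0 `def … : Prop`, 0 sorry).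
HONEST FRAMING (cell contract, verbatim): «discharging `BetaPertH` makes Bałaban's UV stability UNCONDITIONAL — a real constructive-QFT result; it is NOT the continuum limit and NOT
the Clay problem.»  HONEST DEPENDENCY (verbatim): «continuum YM on T⁴ ⇐ BetaPertH ∧ nine spine estimates (0/9 proved); BetaPertH ⇐ (D1) ∧ (D4) ∧ CAP+tail; G-an2-4 gates asym, D1 and NE2/3/4.»
* `sum_weights_spike1_left_le` (`a = α₁·[· = 1]`, `b s ≤ β·Lc^s`), `sum_weights_spike1_right_le` (`a s ≤ α·Lc^s`, `b = β₁·[· = 1]`);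
* **`sum_weights_twospike_geometric_left_le`** (`a s ≤ α₀·[s=0] + α₁·[s=1] + α·Lc^s`, `b s ≤ β·Lc^s`), **`sum_weights_twospike_geometric_right_le`** (the mirror).
NO estimate of Bałaban's; discharges NOTHING of `hCTd′`; NEVER «G-an2-4 closed» as (CONV-C); NOT D1, NOT BetaPertH, NOT continuum, NOT Clay.  2026-08-28; no existing file touched.
-/

noncomputable section

open Finset
open scoped BigOperators
open Summit.QuantumFields.BalabanUV.Beta.GAN24.StaircasePairing (sum_weights_le_of_geometric sum_pow_le)
open Summit.QuantumFields.BalabanUV.Beta.GAN24.ContactRefinePWeights (sum_weights_mono sum_weights_add_left sum_weights_add_right sum_weights_spike_left_le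
  sum_weights_spike_right_le)

namespace Summit.QuantumFields.BalabanUV.Beta.GAN24.CombContactRefinePWeights

section Weights

variable {Lc K : ℕ} {κ₀ τ Φ₀ : ℝ}

/-- NOT IN PRINT; OUR BOOKKEEPING.  **THE SCALE-`1` SPIKE ROW** (`a = α₁·[· = 1]`, `b s ≤ β·Lc^s`, `1 ≤ Lc`): only `s₁ = 1` contributes; against `s₂ ≥ 1` each pair weighs
`≤ 2e^{2κ₀}τα₁β`, against `s₂ = 0` (derivative on the coarser piece) `≤ 2e^{5κ₀}(Φ₀ + τ·Lc⁻¹)α₁β` ⟹ `≤ ((K:ℝ)+1)·(2e^{5κ₀}·(Φ₀ + τ)·α₁·β)`. -/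
theorem sum_weights_spike1_left_le (hκ : 0 ≤ κ₀) (hτ : 0 ≤ τ) (hΦ : 0 ≤ Φ₀) (hLc : 1 ≤ Lc) {α₁ β : ℝ} (hα₁ : 0 ≤ α₁) {b : ℕ → ℝ}
    (hb : ∀ s, 0 ≤ b s) (hbL : ∀ s, b s ≤ β * (Lc : ℝ) ^ s) :
    (∑ s₁ ∈ Finset.range (K + 1), ∑ s₂ ∈ Finset.range (K + 1),
        (if s₁ ≤ s₂ then 2 * Real.exp (2 * κ₀) * τ * (if s₁ = 1 then α₁ else 0) * b s₂ * (((Lc : ℝ) ^ s₂))⁻¹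
         else 2 * Real.exp (5 * κ₀) * (Φ₀ + τ * (((Lc : ℝ) ^ s₁))⁻¹) * (if s₁ = 1 then α₁ else 0) * b s₂))
    ≤ ((K : ℝ) + 1) * (2 * Real.exp (5 * κ₀) * (Φ₀ + τ) * α₁ * β) := by
  have hL0 : (0 : ℝ) < Lc := by exact_mod_cast hLc
  have hL1 : (1 : ℝ) ≤ Lc := by exact_mod_cast hLc
  have hβ0 : 0 ≤ β := by have h := hbL 0; rw [pow_zero, mul_one] at h; exact (hb 0).trans h
  have h25 : Real.exp (2 * κ₀) ≤ Real.exp (5 * κ₀) := Real.exp_le_exp.2 (by nlinarith)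
  set c : ℝ := 2 * Real.exp (5 * κ₀) * (Φ₀ + τ) * α₁ * β with hc
  have hc0 : 0 ≤ c := by positivity
  have hterm : ∀ s₁ ∈ Finset.range (K + 1), ∀ s₂ ∈ Finset.range (K + 1),
      (if s₁ ≤ s₂ then 2 * Real.exp (2 * κ₀) * τ * (if s₁ = 1 then α₁ else 0) * b s₂ * (((Lc : ℝ) ^ s₂))⁻¹
         else 2 * Real.exp (5 * κ₀) * (Φ₀ + τ * (((Lc : ℝ) ^ s₁))⁻¹) * (if s₁ = 1 then α₁ else 0) * b s₂)
        ≤ if s₁ = 1 then c else 0 := by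
    intro s₁ _ s₂ _
    by_cases h1 : s₁ = 1
    · subst h1
      rw [if_pos rfl, if_pos rfl]
      by_cases hle : 1 ≤ s₂
      · rw [if_pos hle]
        have hLs : (0 : ℝ) < (Lc : ℝ) ^ s₂ := pow_pos hL0 _
        have hq : b s₂ * (((Lc : ℝ) ^ s₂))⁻¹ ≤ β := by
          rw [← div_eq_mul_inv, div_le_iff₀ hLs]; exact hbL s₂
        have hq0 : 0 ≤ b s₂ * (((Lc : ℝ) ^ s₂))⁻¹ := mul_nonneg (hb s₂) (by positivity)
        calc 2 * Real.exp (2 * κ₀) * τ * α₁ * b s₂ * ((Lc : ℝ) ^ s₂)⁻¹ = (2 * Real.exp (2 * κ₀) * τ * α₁) * (b s₂ * ((Lc : ℝ) ^ s₂)⁻¹) := by ring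
          _ ≤ (2 * Real.exp (5 * κ₀) * (Φ₀ + τ) * α₁) * β := by
              have h1 := mul_le_mul_of_nonneg_right h25 (mul_nonneg hτ hα₁)
              have h2 : 0 ≤ Real.exp (5 * κ₀) * (Φ₀ * α₁) := by positivity
              exact mul_le_mul (by nlinarith) hq hq0 (by positivity)
          _ = c := by rw [hc]
      · rw [if_neg hle]
        have hs0 : s₂ = 0 := by omega
        subst hs0
        have hb0 : b 0 ≤ β := by have h := hbL 0; rwa [pow_zero, mul_one] at h
        have hinv : τ * (((Lc : ℝ) ^ 1))⁻¹ ≤ τ := by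
          rw [pow_one]; exact (mul_le_mul_of_nonneg_left (inv_le_one_of_one_le₀ hL1) hτ).trans (by rw [mul_one])
        calc 2 * Real.exp (5 * κ₀) * (Φ₀ + τ * ((Lc : ℝ) ^ 1)⁻¹) * α₁ * b 0
            ≤ 2 * Real.exp (5 * κ₀) * (Φ₀ + τ) * α₁ * β := by
              have h1 : Φ₀ + τ * ((Lc : ℝ) ^ 1)⁻¹ ≤ Φ₀ + τ := by linarith
              have h1' : 0 ≤ Φ₀ + τ * ((Lc : ℝ) ^ 1)⁻¹ := by positivity
              exact mul_le_mul (mul_le_mul_of_nonneg_right (mul_le_mul_of_nonneg_left h1 (by positivity)) hα₁) hb0 (hb 0) (by positivity)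
          _ = c := by rw [hc]
    · rw [if_neg h1, if_neg h1]
      split_ifs <;> simp
  calc _ ≤ ∑ s₁ ∈ Finset.range (K + 1), ∑ _s₂ ∈ Finset.range (K + 1), (if s₁ = 1 then c else 0) :=
        Finset.sum_le_sum fun s₁ hs₁ => Finset.sum_le_sum fun s₂ hs₂ => hterm s₁ hs₁ s₂ hs₂
    _ = ((K : ℝ) + 1) * ∑ s₁ ∈ Finset.range (K + 1), (if s₁ = 1 then c else 0) := by
        rw [Finset.sum_comm, Finset.sum_const, Finset.card_range, nsmul_eq_mul]; push_cast; ring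
    _ ≤ ((K : ℝ) + 1) * c := by
        refine mul_le_mul_of_nonneg_left ?_ (by positivity)
        rw [Finset.sum_ite_eq' (Finset.range (K + 1)) 1]
        split_ifs
        · exact le_rfl
        · exact hc0

/-- NOT IN PRINT; OUR BOOKKEEPING.  **THE SCALE-`1` SPIKE COLUMN** (`a s ≤ α·Lc^s`, `b = β₁·[· = 1]`, `2 ≤ Lc`): only `s₂ = 1` contributes; the pairs `s₁ ≤ 1` weigh `≤ 2e^{2κ₀}ταβ₁`
(`Lc^{s₁}·Lc⁻¹ ≤ 1`), the pairs `s₁ ≥ 2` weigh `≤ 2e^{5κ₀}β₁(Φ₀αLc^{s₁} + τα)` ⟹ `≤ 2e^{5κ₀}·α·β₁·(((K:ℝ)+1)·τ + 2·Φ₀·Lc^K)`. -/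
theorem sum_weights_spike1_right_le (hκ : 0 ≤ κ₀) (hτ : 0 ≤ τ) (hΦ : 0 ≤ Φ₀) (hLc : 2 ≤ Lc) {α β₁ : ℝ} (hα : 0 ≤ α) (hβ₁ : 0 ≤ β₁)
    {a : ℕ → ℝ} (ha : ∀ s, 0 ≤ a s) (haL : ∀ s, a s ≤ α * (Lc : ℝ) ^ s) :
    (∑ s₁ ∈ Finset.range (K + 1), ∑ s₂ ∈ Finset.range (K + 1),
        (if s₁ ≤ s₂ then 2 * Real.exp (2 * κ₀) * τ * a s₁ * (if s₂ = 1 then β₁ else 0) * (((Lc : ℝ) ^ s₂))⁻¹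
         else 2 * Real.exp (5 * κ₀) * (Φ₀ + τ * (((Lc : ℝ) ^ s₁))⁻¹) * a s₁ * (if s₂ = 1 then β₁ else 0)))
    ≤ 2 * Real.exp (5 * κ₀) * α * β₁ * (((K : ℝ) + 1) * τ + 2 * Φ₀ * (Lc : ℝ) ^ K) := by
  have hL : (2 : ℝ) ≤ (Lc : ℝ) := by exact_mod_cast hLc
  have hL0 : (0 : ℝ) < (Lc : ℝ) := by linarith
  have h25 : Real.exp (2 * κ₀) ≤ Real.exp (5 * κ₀) := Real.exp_le_exp.2 (by nlinarith)
  -- each `s₁`: the `s₂ = 1` term only, bounded by `2e^{5κ₀}β₁(τα + Φ₀αLc^{s₁})`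
  have hrow : ∀ s₁ ∈ Finset.range (K + 1),
      (∑ s₂ ∈ Finset.range (K + 1),
        (if s₁ ≤ s₂ then 2 * Real.exp (2 * κ₀) * τ * a s₁ * (if s₂ = 1 then β₁ else 0) * (((Lc : ℝ) ^ s₂))⁻¹
         else 2 * Real.exp (5 * κ₀) * (Φ₀ + τ * (((Lc : ℝ) ^ s₁))⁻¹) * a s₁ * (if s₂ = 1 then β₁ else 0)))
        ≤ 2 * Real.exp (5 * κ₀) * β₁ * (τ * α + Φ₀ * (α * (Lc : ℝ) ^ s₁)) := by
    intro s₁ _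
    have hterm : ∀ s₂ ∈ Finset.range (K + 1),
        (if s₁ ≤ s₂ then 2 * Real.exp (2 * κ₀) * τ * a s₁ * (if s₂ = 1 then β₁ else 0) * (((Lc : ℝ) ^ s₂))⁻¹
         else 2 * Real.exp (5 * κ₀) * (Φ₀ + τ * (((Lc : ℝ) ^ s₁))⁻¹) * a s₁ * (if s₂ = 1 then β₁ else 0))
          ≤ if s₂ = 1 then 2 * Real.exp (5 * κ₀) * β₁ * (τ * α + Φ₀ * (α * (Lc : ℝ) ^ s₁)) else 0 := by
      intro s₂ _
      by_cases h1 : s₂ = 1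
      · subst h1
        rw [if_pos rfl, if_pos rfl]
        have hLs1 : (0 : ℝ) < (Lc : ℝ) ^ s₁ := pow_pos hL0 _
        by_cases hle : s₁ ≤ 1
        · rw [if_pos hle, pow_one]
          -- `a s₁ · Lc⁻¹ ≤ α` since `a s₁ ≤ α·Lc^{s₁} ≤ α·Lc`
          have hLs : (Lc : ℝ) ^ s₁ ≤ (Lc : ℝ) := by
            calc (Lc : ℝ) ^ s₁ ≤ (Lc : ℝ) ^ 1 := pow_le_pow_right₀ (by linarith) hle
              _ = (Lc : ℝ) := pow_one _
          have hq : a s₁ * ((Lc : ℝ))⁻¹ ≤ α := by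
            rw [← div_eq_mul_inv, div_le_iff₀ hL0]
            exact (haL s₁).trans (mul_le_mul_of_nonneg_left hLs hα)
          have hq0 : 0 ≤ a s₁ * ((Lc : ℝ))⁻¹ := mul_nonneg (ha s₁) (by positivity)
          calc 2 * Real.exp (2 * κ₀) * τ * a s₁ * β₁ * ((Lc : ℝ))⁻¹ = (2 * Real.exp (2 * κ₀) * τ * β₁) * (a s₁ * ((Lc : ℝ))⁻¹) := by ring
            _ ≤ (2 * Real.exp (5 * κ₀) * τ * β₁) * α := by
                have h1 := mul_le_mul_of_nonneg_right h25 (mul_nonneg hτ hβ₁)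
                exact mul_le_mul (by nlinarith) hq hq0 (by positivity)
            _ ≤ 2 * Real.exp (5 * κ₀) * β₁ * (τ * α + Φ₀ * (α * (Lc : ℝ) ^ s₁)) := by
                have h2 : 0 ≤ 2 * Real.exp (5 * κ₀) * β₁ * (Φ₀ * (α * (Lc : ℝ) ^ s₁)) := by positivity
                nlinarith
        · rw [if_neg hle]
          have hτq : τ * ((((Lc : ℝ) ^ s₁))⁻¹ * a s₁) ≤ τ * α := by
            refine mul_le_mul_of_nonneg_left ?_ hτ
            rw [← div_eq_inv_mul, div_le_iff₀ hLs1]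
            exact (haL s₁).trans (le_of_eq (by ring))
          have hΦq : Φ₀ * a s₁ ≤ Φ₀ * (α * (Lc : ℝ) ^ s₁) := mul_le_mul_of_nonneg_left (haL s₁) hΦ
          calc 2 * Real.exp (5 * κ₀) * (Φ₀ + τ * ((Lc : ℝ) ^ s₁)⁻¹) * a s₁ * β₁
              = 2 * Real.exp (5 * κ₀) * β₁ * (τ * ((((Lc : ℝ) ^ s₁))⁻¹ * a s₁) + Φ₀ * a s₁) := by ring
            _ ≤ 2 * Real.exp (5 * κ₀) * β₁ * (τ * α + Φ₀ * (α * (Lc : ℝ) ^ s₁)) :=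
                mul_le_mul_of_nonneg_left (add_le_add hτq hΦq) (by positivity)
      · rw [if_neg h1, if_neg h1]
        split_ifs <;> simp
    refine (Finset.sum_le_sum hterm).trans ?_
    rw [Finset.sum_ite_eq' (Finset.range (K + 1)) 1]
    split_ifs
    · exact le_rfl
    · positivity
  refine (Finset.sum_le_sum hrow).trans ?_
  have hsum := sum_pow_le hL K
  have e : ∀ s₁ : ℕ, 2 * Real.exp (5 * κ₀) * β₁ * (τ * α + Φ₀ * (α * (Lc : ℝ) ^ s₁))
      = 2 * Real.exp (5 * κ₀) * β₁ * τ * α + (2 * Real.exp (5 * κ₀) * β₁ * Φ₀ * α) * (Lc : ℝ) ^ s₁ := fun s₁ => by ring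
  rw [Finset.sum_congr rfl fun s₁ _ => e s₁, Finset.sum_add_distrib, Finset.sum_const, Finset.card_range, nsmul_eq_mul, ← Finset.mul_sum]
  have hc0 : 0 ≤ 2 * Real.exp (5 * κ₀) * β₁ * Φ₀ * α := by positivity
  have h2 := mul_le_mul_of_nonneg_left hsum hc0
  push_cast
  nlinarith [h2]

/-- NOT IN PRINT; OUR BOOKKEEPING.  **«GEOMETRIC + TWO FINEST SPIKES» IN THE FIRST FAMILY** (`a s ≤ α₀·[s = 0] + α₁·[s = 1] + α·Lc^s`, `b s ≤ β·Lc^s`, `2 ≤ Lc`):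
`Σ w ≤ ((K:ℝ)+1)·(2e^{2κ₀}τα₀β) + ((K:ℝ)+1)·(2e^{5κ₀}(Φ₀+τ)α₁β) + 8e^{5κ₀}·α·β·Lc^K·(2τ + Φ₀·Lc^K)` (additivity + the two spike rows + the OWNER's `sum_weights_le_of_geometric`). -/
theorem sum_weights_twospike_geometric_left_le (hκ : 0 ≤ κ₀) (hτ : 0 ≤ τ) (hΦ : 0 ≤ Φ₀) (hLc : 2 ≤ Lc) {α₀ α₁ α β : ℝ}
    (hα₀ : 0 ≤ α₀) (hα₁ : 0 ≤ α₁) (hα : 0 ≤ α) (hβ : 0 ≤ β) {a b : ℕ → ℝ} (ha : ∀ s, 0 ≤ a s) (hb : ∀ s, 0 ≤ b s)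
    (haL : ∀ s, a s ≤ (if s = 0 then α₀ else 0) + (if s = 1 then α₁ else 0) + α * (Lc : ℝ) ^ s) (hbL : ∀ s, b s ≤ β * (Lc : ℝ) ^ s) :
    (∑ s₁ ∈ Finset.range (K + 1), ∑ s₂ ∈ Finset.range (K + 1),
        (if s₁ ≤ s₂ then 2 * Real.exp (2 * κ₀) * τ * a s₁ * b s₂ * (((Lc : ℝ) ^ s₂))⁻¹
         else 2 * Real.exp (5 * κ₀) * (Φ₀ + τ * (((Lc : ℝ) ^ s₁))⁻¹) * a s₁ * b s₂))
    ≤ ((K : ℝ) + 1) * (2 * Real.exp (2 * κ₀) * τ * α₀ * β) + ((K : ℝ) + 1) * (2 * Real.exp (5 * κ₀) * (Φ₀ + τ) * α₁ * β)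
      + 8 * Real.exp (5 * κ₀) * α * β * (Lc : ℝ) ^ K * (2 * τ + Φ₀ * (Lc : ℝ) ^ K) := by
  have hL1 : 1 ≤ Lc := le_trans (by norm_num) hLc
  refine (sum_weights_mono (K := K) (κ₀ := κ₀) (Lc := Lc) hτ hΦ ha haL (fun s => le_rfl) hb).trans ?_
  rw [sum_weights_add_left, sum_weights_add_left]
  refine add_le_add (add_le_add (sum_weights_spike_left_le (Φ₀ := Φ₀) hτ hL1 hα₀ hb hbL)
    (sum_weights_spike1_left_le hκ hτ hΦ hL1 hα₁ hb hbL)) ?_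
  exact sum_weights_le_of_geometric hLc hκ hτ hΦ hα hβ (fun s => by positivity) hb (fun s => le_rfl) hbL

/-- NOT IN PRINT; OUR BOOKKEEPING.  **«GEOMETRIC + TWO FINEST SPIKES» IN THE SECOND FAMILY** (`a s ≤ α·Lc^s`, `b s ≤ β₀·[s = 0] + β₁·[s = 1] + β·Lc^s`, `2 ≤ Lc`):
`Σ w ≤ 2e^{5κ₀}αβ₀(((K:ℝ)+1)τ + 2Φ₀Lc^K) + 2e^{5κ₀}αβ₁(((K:ℝ)+1)τ + 2Φ₀Lc^K) + 8e^{5κ₀}αβLc^K(2τ + Φ₀Lc^K)`. -/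
theorem sum_weights_twospike_geometric_right_le (hκ : 0 ≤ κ₀) (hτ : 0 ≤ τ) (hΦ : 0 ≤ Φ₀) (hLc : 2 ≤ Lc) {α β₀ β₁ β : ℝ}
    (hα : 0 ≤ α) (hβ₀ : 0 ≤ β₀) (hβ₁ : 0 ≤ β₁) (hβ : 0 ≤ β) {a b : ℕ → ℝ} (ha : ∀ s, 0 ≤ a s) (hb : ∀ s, 0 ≤ b s)
    (haL : ∀ s, a s ≤ α * (Lc : ℝ) ^ s) (hbL : ∀ s, b s ≤ (if s = 0 then β₀ else 0) + (if s = 1 then β₁ else 0) + β * (Lc : ℝ) ^ s) :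
    (∑ s₁ ∈ Finset.range (K + 1), ∑ s₂ ∈ Finset.range (K + 1),
        (if s₁ ≤ s₂ then 2 * Real.exp (2 * κ₀) * τ * a s₁ * b s₂ * (((Lc : ℝ) ^ s₂))⁻¹
         else 2 * Real.exp (5 * κ₀) * (Φ₀ + τ * (((Lc : ℝ) ^ s₁))⁻¹) * a s₁ * b s₂))
    ≤ 2 * Real.exp (5 * κ₀) * α * β₀ * (((K : ℝ) + 1) * τ + 2 * Φ₀ * (Lc : ℝ) ^ K)
      + 2 * Real.exp (5 * κ₀) * α * β₁ * (((K : ℝ) + 1) * τ + 2 * Φ₀ * (Lc : ℝ) ^ K)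
      + 8 * Real.exp (5 * κ₀) * α * β * (Lc : ℝ) ^ K * (2 * τ + Φ₀ * (Lc : ℝ) ^ K) := by
  refine (sum_weights_mono (K := K) (κ₀ := κ₀) (Lc := Lc) hτ hΦ ha (fun s => le_rfl) hbL hb).trans ?_
  rw [sum_weights_add_right, sum_weights_add_right]
  refine add_le_add (add_le_add (sum_weights_spike_right_le hκ hτ hΦ hLc hα hβ₀ ha haL)
    (sum_weights_spike1_right_le hκ hτ hΦ hLc hα hβ₁ ha haL)) ?_
  exact sum_weights_le_of_geometric hLc hκ hτ hΦ hα hβ ha (fun s => by positivity) haL (fun s => le_rfl)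

end Weights

end Summit.QuantumFields.BalabanUV.Beta.GAN24.CombContactRefinePWeights

end
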